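import Mathlib
import HarnessLib
import Literature.MathematicalPhysics.StatisticalMechanics.GaussianWeightStepMonotone

/-!
# The tower of large-field weight forms `A_k^X`, `A_{k:k+1}^X` (Adams–Buchholz–Kotecký–Müller (7.5),
# Lemma 7.5)

[ABKM19] Ch. 7.1 defines the weak-norm weights `w_k^X(φ) = e^{½(A_k^X φ, φ)}`,
`w_{k:k+1}^X(φ) = e^{½(A_{k:k+1}^X φ, φ)}` through symmetric operators given ITERATIVELY by (7.5):

* `A_0^X` an explicit local seed (`(1−4θ̄)Σ_{x∈X}Ω(Dφ(x)) + δ₀(φ, M₀^X φ)`),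
* `A_{k:k+1}^X = ((A_k^X)⁻¹ − (1+θ̄)𝒞_{k+1})⁻¹` — one Gaussian integration step, in the tree the
  invertibility-free `nextForm (A_k^X) ((1+θ̄)𝒞_{k+1})` (`GaussianWeightStep.lean`),
* `A_{k+1}^X = A_{k:k+1}^{X*} + δ_{k+1} M_{k+1}^X` — enlargement to the small-set neighbourhood and
  addition of the higher-derivative form.

This file builds that tower for ABSTRACT data `W : WeightData Λ` on a finite index set `Λ` (seed
forms `W.seed X`, step covariances `W.cov k`, perturbations `W.pert k X = δ_k M_k^X`, enlargement
`W.enl k X = X*`) — `W.form k X = A_k^X`, `W.midForm k X = A_{k:k+1}^X`, `W.weight`, `W.midWeight` —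
and proves the STRUCTURAL half of Lemma 7.5 by induction on `k`, the analytic input being packaged
as a DOMINATING SEQUENCE `D k` (Lemma 7.5 (v): in the source
`D_k = (λM_k⁻¹ + (1+θ_k)Σ_{j>k}𝒞_j)⁻¹`, whose step inequality `nextForm D_k + δ_{k+1}M_{k+1} ⪯ D_{k+1}`
is Lemma 7.3 + (7.43)–(7.45)):

* `WeightData.Dominated` ⇒ `form_isSymm`, `form_posSemidef`, `form_le` (`A_k^X ⪯ D_k`),
  `form_subcritical` (`1 − √C_k A_k^X √C_k ≻ 0`: the Gaussian step is WELL DEFINED, Lemma 7.5 (i)),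
  `midForm_posSemidef`, `midForm_le` (Lemma 7.5 (i),(v));
* `WeightData.Monotone` ⇒ `form_mono`, `midForm_mono`, `weight_mono`, `midWeight_mono`
  (Lemma 7.5 (iv) = Theorem 7.1 (w1)), via `nextForm_mono` (Lemma 7.2);
* `weight_le_exp` (shape of Theorem 7.1 (w2): `w_k^X(φ) ≤ e^{½(D_kφ,φ)}`);
* locality (Lemma 7.5 (iii)): `IsGradLocal A S` ("`A` sees only the gradients of the field inside
  `S`": `Aφ = 0` whenever `φ` is constant on `S`) is preserved by `nextForm` for EVERY covariance and
  by the recursion (`form_isGradLocal`) when `(X*)^{++}_k ⊆ X^{++}_{k+1}`.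

Everything is proved; no named fact.  What is NOT here: the additivity over separated polymers
(Lemma 7.6, Theorem 7.1 (w3)–(w6)), the integration property (Lemma 7.7, (w7)–(w8)), (w9), and the
construction of a dominating sequence for the concrete data of [ABKM19] (Lemma 7.3).

## References
* S. Adams, S. Buchholz, R. Kotecký, S. Müller, arXiv:1910.13564, Ch. 7.1 (7.5)–(7.6), Lemma 7.5
  [AdamsBuchholzKoteckyMuller2019].
-/

noncomputable section

open Matrix
open scoped Matrix MatrixOrder

namespace Literature.MathematicalPhysics.StatisticalMechanics.GradientRG

variable {Λ : Type*} [Fintype Λ] [DecidableEq Λ]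

/-- **Data of a weight tower** ([ABKM19] (7.5)): seed forms `A_0^X = seed X`, the covariance
`cov k` integrated in the step `k → k+1` (in the source `(1+θ̄)𝒞_{k+1}`), the added forms
`pert k X = δ_k M_k^X` (`k ≥ 1`), and the enlargement `enl k X = X*` applied to `X ∈ 𝒫_k`.
[cite: AdamsBuchholzKoteckyMuller2019, Ch. 7.1 (7.5)] -/
structure WeightData (Λ : Type*) [Fintype Λ] [DecidableEq Λ] where
  /-- the scale-`0` forms `A_0^X` -/
  seed : Finset Λ → Matrix Λ Λ ℝ
  /-- the covariance of the step `k → k+1` -/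
  cov : ℕ → Matrix Λ Λ ℝ
  /-- the forms `δ_k M_k^X` added at scale `k` -/
  pert : ℕ → Finset Λ → Matrix Λ Λ ℝ
  /-- the enlargement `X ↦ X*` of a scale-`k` polymer -/
  enl : ℕ → Finset Λ → Finset Λ

namespace WeightData

variable (W : WeightData Λ)

/-- **`A_k^X`** ([ABKM19] (7.5)): `A_0^X = seed X`,
`A_{k+1}^X = nextForm (A_k^{X*}) (cov k) + δ_{k+1}M_{k+1}^X`.
[cite: AdamsBuchholzKoteckyMuller2019, Ch. 7.1 (7.5)] -/
def form : ℕ → Finset Λ → Matrix Λ Λ ℝ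
  | 0 => fun X => W.seed X
  | k + 1 => fun X => nextForm (form k (W.enl (k + 1) X)) (W.cov k) + W.pert (k + 1) X

/-- **`A_{k:k+1}^X = nextForm (A_k^X) (cov k)`** ([ABKM19] (7.5), middle line).
[cite: AdamsBuchholzKoteckyMuller2019, Ch. 7.1 (7.5)] -/
def midForm (k : ℕ) (X : Finset Λ) : Matrix Λ Λ ℝ :=
  nextForm (W.form k X) (W.cov k)

/-- **`w_k^X(φ) = exp(½ (φ, A_k^X φ))`** ([ABKM19] (7.4)).
[cite: AdamsBuchholzKoteckyMuller2019, Ch. 7.1 (7.4)] -/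
def weight (k : ℕ) (X : Finset Λ) (φ : Λ → ℝ) : ℝ :=
  Real.exp ((1/2 : ℝ) * (φ ⬝ᵥ W.form k X *ᵥ φ))

/-- **`w_{k:k+1}^X(φ) = exp(½ (φ, A_{k:k+1}^X φ))`** ([ABKM19] (7.4)).
[cite: AdamsBuchholzKoteckyMuller2019, Ch. 7.1 (7.4)] -/
def midWeight (k : ℕ) (X : Finset Λ) (φ : Λ → ℝ) : ℝ :=
  Real.exp ((1/2 : ℝ) * (φ ⬝ᵥ W.midForm k X *ᵥ φ))

/-- Unfolding at scale `0`. [cite: AdamsBuchholzKoteckyMuller2019, Ch. 7.1 (7.5)] -/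
@[simp] theorem form_zero (X : Finset Λ) : W.form 0 X = W.seed X := rfl

/-- Unfolding of the step. [cite: AdamsBuchholzKoteckyMuller2019, Ch. 7.1 (7.5)] -/
theorem form_succ (k : ℕ) (X : Finset Λ) :
    W.form (k + 1) X = W.midForm k (W.enl (k + 1) X) + W.pert (k + 1) X := rfl

/-! ## Domination by a sequence `D_k` (Lemma 7.5 (i), (v)) -/

/-- **Hypotheses of Lemma 7.5 in dominated form.** The seeds are symmetric, non-negative and
`⪯ D₀`; the added forms are non-negative; each `D_k` is symmetric and SUBCRITICAL for `cov k`; and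
the step inequality `nextForm D_k (cov k) + δ_{k+1}M_{k+1}^X ⪯ D_{k+1}` holds (in [ABKM19]:
`D_k = (λM_k⁻¹ + (1+θ_k)Σ_{j>k}𝒞_j)⁻¹`, the step being Lemma 7.3 with (7.43)–(7.45)).
[cite: AdamsBuchholzKoteckyMuller2019, Lemma 7.5 (v)] -/
structure Dominated (D : ℕ → Matrix Λ Λ ℝ) : Prop where
  /-- `A_0^X` symmetric -/
  seed_isSymm : ∀ X, (W.seed X).IsSymm
  /-- `A_0^X ⪰ 0` -/
  seed_posSemidef : ∀ X, (W.seed X).PosSemidef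
  /-- `A_0^X ⪯ D_0` -/
  seed_le : ∀ X, (D 0 - W.seed X).PosSemidef
  /-- `δ_k M_k^X ⪰ 0` -/
  pert_posSemidef : ∀ k X, (W.pert k X).PosSemidef
  /-- `D_k` symmetric -/
  dom_isSymm : ∀ k, (D k).IsSymm
  /-- `D_k` subcritical for the step covariance -/
  dom_subcritical : ∀ k, ((1 : Matrix Λ Λ ℝ) - CFC.sqrt (W.cov k) * D k * CFC.sqrt (W.cov k)).PosDef
  /-- the step inequality -/
  step_le : ∀ k X, (D (k + 1) - (nextForm (D k) (W.cov k) + W.pert (k + 1) X)).PosSemidef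

variable {W}

omit [Fintype Λ] [DecidableEq Λ] in
/-- A real positive semidefinite matrix is symmetric (plumbing). [folklore] -/
private theorem isSymm_of_posSemidef' {A : Matrix Λ Λ ℝ} (h : A.PosSemidef) :
    A.IsSymm :=
  isHermitian_iff_isSymm.1 h.1

/-- **Lemma 7.5 (i),(v) along the tower**: under `Dominated D`, every `A_k^X` is symmetric,
non-negative and `⪯ D_k`. [cite: AdamsBuchholzKoteckyMuller2019, Lemma 7.5 (i),(v)] -/
theorem form_isSymm_posSemidef_le {D : ℕ → Matrix Λ Λ ℝ} (h : W.Dominated D) :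
    ∀ k X, (W.form k X).IsSymm ∧ (W.form k X).PosSemidef ∧ (D k - W.form k X).PosSemidef := by
  intro k
  induction k with
  | zero => exact fun X => ⟨h.seed_isSymm X, h.seed_posSemidef X, h.seed_le X⟩
  | succ k ih =>
    intro X
    obtain ⟨hs, hp, hle⟩ := ih (W.enl (k + 1) X)
    -- subcriticality of `A_k^{X*}` from `A_k^{X*} ⪯ D_k`
    have hsub := posDef_one_sub_sqrt_mul_sqrt_anti hle (h.dom_subcritical k)
    have hmono := nextForm_mono hs (h.dom_isSymm k) hle (h.dom_subcritical k)
    have hpsd := posSemidef_nextForm hp hsub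
    refine ⟨(isSymm_nextForm hs _).add (isSymm_of_posSemidef' (h.pert_posSemidef (k + 1) X)),
      hpsd.add (h.pert_posSemidef (k + 1) X), ?_⟩
    -- `D_{k+1} − A_{k+1}^X = (D_{k+1} − (nextForm D_k + M)) + (nextForm D_k − nextForm A_k^{X*})`
    have := (h.step_le k X).add hmono
    rw [form_succ, midForm]
    convert this using 1
    abel

/-- `A_k^X` is symmetric. [cite: AdamsBuchholzKoteckyMuller2019, Lemma 7.5 (i)] -/
theorem form_isSymm {D : ℕ → Matrix Λ Λ ℝ} (h : W.Dominated D) (k : ℕ) (X : Finset Λ) :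
    (W.form k X).IsSymm :=
  (form_isSymm_posSemidef_le h k X).1

/-- `A_k^X ⪰ 0`. [cite: AdamsBuchholzKoteckyMuller2019, Lemma 7.5 (i)] -/
theorem form_posSemidef {D : ℕ → Matrix Λ Λ ℝ} (h : W.Dominated D) (k : ℕ) (X : Finset Λ) :
    (W.form k X).PosSemidef :=
  (form_isSymm_posSemidef_le h k X).2.1

/-- **`A_k^X ⪯ D_k`** (Lemma 7.5 (v), (7.30) first line).
[cite: AdamsBuchholzKoteckyMuller2019, Lemma 7.5 (v)] -/
theorem form_le {D : ℕ → Matrix Λ Λ ℝ} (h : W.Dominated D) (k : ℕ) (X : Finset Λ) :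
    (D k - W.form k X).PosSemidef :=
  (form_isSymm_posSemidef_le h k X).2.2

/-- **The Gaussian step is well defined** (Lemma 7.5 (i): `A_k^X < ((1+θ̄)𝒞_{k+1})⁻¹`):
`1 − √(cov k) A_k^X √(cov k) ≻ 0`. [cite: AdamsBuchholzKoteckyMuller2019, Lemma 7.5 (i)] -/
theorem form_subcritical {D : ℕ → Matrix Λ Λ ℝ} (h : W.Dominated D) (k : ℕ) (X : Finset Λ) :
    ((1 : Matrix Λ Λ ℝ) - CFC.sqrt (W.cov k) * W.form k X * CFC.sqrt (W.cov k)).PosDef :=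
  posDef_one_sub_sqrt_mul_sqrt_anti (form_le h k X) (h.dom_subcritical k)

/-- `A_{k:k+1}^X` is symmetric. [cite: AdamsBuchholzKoteckyMuller2019, Lemma 7.5 (i)] -/
theorem midForm_isSymm {D : ℕ → Matrix Λ Λ ℝ} (h : W.Dominated D) (k : ℕ) (X : Finset Λ) :
    (W.midForm k X).IsSymm :=
  isSymm_nextForm (form_isSymm h k X) _

/-- `A_{k:k+1}^X ⪰ 0`. [cite: AdamsBuchholzKoteckyMuller2019, Lemma 7.5 (i)] -/
theorem midForm_posSemidef {D : ℕ → Matrix Λ Λ ℝ} (h : W.Dominated D) (k : ℕ) (X : Finset Λ) :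
    (W.midForm k X).PosSemidef :=
  posSemidef_nextForm (form_posSemidef h k X) (form_subcritical h k X)

/-- `A_k^X ⪯ A_{k:k+1}^X` (the step only enlarges the form).
[cite: AdamsBuchholzKoteckyMuller2019, Lemma 7.2 (7.23)] -/
theorem form_le_midForm {D : ℕ → Matrix Λ Λ ℝ} (h : W.Dominated D) (k : ℕ) (X : Finset Λ) :
    (W.midForm k X - W.form k X).PosSemidef :=
  posSemidef_nextForm_sub (form_isSymm h k X) (form_subcritical h k X)

/-- **`A_{k:k+1}^X ⪯ nextForm D_k (cov k)`** (Lemma 7.5 (v), (7.30) second line / (7.43)).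
[cite: AdamsBuchholzKoteckyMuller2019, Lemma 7.5 (v)] -/
theorem midForm_le {D : ℕ → Matrix Λ Λ ℝ} (h : W.Dominated D) (k : ℕ) (X : Finset Λ) :
    (nextForm (D k) (W.cov k) - W.midForm k X).PosSemidef :=
  nextForm_mono (form_isSymm h k X) (h.dom_isSymm k) (form_le h k X) (h.dom_subcritical k)

/-- `A_{k:k+1}^{X*} ⪯ A_{k+1}^X`. [cite: AdamsBuchholzKoteckyMuller2019, Ch. 7.1 (7.5)] -/
theorem midForm_enl_le_form_succ {D : ℕ → Matrix Λ Λ ℝ} (h : W.Dominated D) (k : ℕ)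
    (X : Finset Λ) : (W.form (k + 1) X - W.midForm k (W.enl (k + 1) X)).PosSemidef := by
  rw [form_succ, add_sub_cancel_left]
  exact h.pert_posSemidef (k + 1) X

/-! ## Shape of Theorem 7.1 (w2): comparison of the weights with `e^{½(D_kφ,φ)}` -/

/-- The weights are positive. [cite: AdamsBuchholzKoteckyMuller2019, Ch. 7.1 (7.4)] -/
theorem weight_pos (k : ℕ) (X : Finset Λ) (φ : Λ → ℝ) : 0 < W.weight k X φ := Real.exp_pos _

/-- The mid-weights are positive. [cite: AdamsBuchholzKoteckyMuller2019, Ch. 7.1 (7.4)] -/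
theorem midWeight_pos (k : ℕ) (X : Finset Λ) (φ : Λ → ℝ) : 0 < W.midWeight k X φ := Real.exp_pos _

/-- `1 ≤ w_k^X(φ)`. [cite: AdamsBuchholzKoteckyMuller2019, Lemma 7.5 (i)] -/
theorem one_le_weight {D : ℕ → Matrix Λ Λ ℝ} (h : W.Dominated D) (k : ℕ) (X : Finset Λ)
    (φ : Λ → ℝ) : 1 ≤ W.weight k X φ := by
  have h0 := (form_posSemidef h k X).dotProduct_mulVec_nonneg φ
  rw [star_trivial] at h0
  exact Real.one_le_exp (by positivity)

omit [DecidableEq Λ] in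
/-- Comparison of exponential weights from comparison of forms: `A ⪯ B ⇒ e^{½(Aφ,φ)} ≤ e^{½(Bφ,φ)}`.
[cite: AdamsBuchholzKoteckyMuller2019, Theorem 7.1 (w1)] -/
theorem exp_half_quadForm_le_of_posSemidef_sub {A B : Matrix Λ Λ ℝ} (hAB : (B - A).PosSemidef)
    (φ : Λ → ℝ) :
    Real.exp ((1/2 : ℝ) * (φ ⬝ᵥ A *ᵥ φ)) ≤ Real.exp ((1/2 : ℝ) * (φ ⬝ᵥ B *ᵥ φ)) := by
  have h0 := hAB.dotProduct_mulVec_nonneg φ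
  rw [star_trivial, Matrix.sub_mulVec, dotProduct_sub] at h0
  exact Real.exp_le_exp.2 (by linarith)

/-- **Shape of (w2)**: `w_k^X(φ) ≤ e^{½(D_kφ,φ)}`. [cite: AdamsBuchholzKoteckyMuller2019, Theorem 7.1 (w2)] -/
theorem weight_le_exp {D : ℕ → Matrix Λ Λ ℝ} (h : W.Dominated D) (k : ℕ) (X : Finset Λ)
    (φ : Λ → ℝ) : W.weight k X φ ≤ Real.exp ((1/2 : ℝ) * (φ ⬝ᵥ D k *ᵥ φ)) :=
  exp_half_quadForm_le_of_posSemidef_sub (form_le h k X) φ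

/-- **Shape of (w2)**: `w_{k:k+1}^X(φ) ≤ e^{½(nextForm D_k φ,φ)}`.
[cite: AdamsBuchholzKoteckyMuller2019, Theorem 7.1 (w2)] -/
theorem midWeight_le_exp {D : ℕ → Matrix Λ Λ ℝ} (h : W.Dominated D) (k : ℕ) (X : Finset Λ)
    (φ : Λ → ℝ) :
    W.midWeight k X φ ≤ Real.exp ((1/2 : ℝ) * (φ ⬝ᵥ nextForm (D k) (W.cov k) *ᵥ φ)) :=
  exp_half_quadForm_le_of_posSemidef_sub (midForm_le h k X) φ

/-- `w_k^X ≤ w_{k:k+1}^X`. [cite: AdamsBuchholzKoteckyMuller2019, Lemma 7.2 (7.23)] -/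
theorem weight_le_midWeight {D : ℕ → Matrix Λ Λ ℝ} (h : W.Dominated D) (k : ℕ) (X : Finset Λ)
    (φ : Λ → ℝ) : W.weight k X φ ≤ W.midWeight k X φ :=
  exp_half_quadForm_le_of_posSemidef_sub (form_le_midForm h k X) φ

/-- `w_{k:k+1}^{X*} ≤ w_{k+1}^X`. [cite: AdamsBuchholzKoteckyMuller2019, Ch. 7.1 (7.5)] -/
theorem midWeight_enl_le_weight_succ {D : ℕ → Matrix Λ Λ ℝ} (h : W.Dominated D) (k : ℕ)
    (X : Finset Λ) (φ : Λ → ℝ) : W.midWeight k (W.enl (k + 1) X) φ ≤ W.weight (k + 1) X φ :=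
  exp_half_quadForm_le_of_posSemidef_sub (midForm_enl_le_form_succ h k X) φ

/-! ## Monotonicity in the polymer (Lemma 7.5 (iv), Theorem 7.1 (w1)) -/

/-- **Monotone data**: the seeds and the added forms are monotone in `X`, and so is the
enlargement. [cite: AdamsBuchholzKoteckyMuller2019, Lemma 7.5 (iv)] -/
structure Monotone : Prop where
  /-- `A_0^X ⪯ A_0^Y` for `X ⊆ Y` -/
  seed_mono : ∀ X Y, X ⊆ Y → (W.seed Y - W.seed X).PosSemidef
  /-- `M_k^X ⪯ M_k^Y` for `X ⊆ Y` -/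
  pert_mono : ∀ k X Y, X ⊆ Y → (W.pert k Y - W.pert k X).PosSemidef
  /-- `X* ⊆ Y*` for `X ⊆ Y` -/
  enl_mono : ∀ k X Y, X ⊆ Y → W.enl k X ⊆ W.enl k Y

/-- **Lemma 7.5 (iv)**: `A_k^X ⪯ A_k^Y` for `X ⊆ Y`.
[cite: AdamsBuchholzKoteckyMuller2019, Lemma 7.5 (iv)] -/
theorem form_mono {D : ℕ → Matrix Λ Λ ℝ} (h : W.Dominated D) (hm : W.Monotone) :
    ∀ k {X Y : Finset Λ}, X ⊆ Y → (W.form k Y - W.form k X).PosSemidef := by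
  intro k
  induction k with
  | zero => exact fun hXY => hm.seed_mono _ _ hXY
  | succ k ih =>
    intro X Y hXY
    have hXY' := hm.enl_mono (k + 1) X Y hXY
    have hmono := nextForm_mono (form_isSymm h k _) (form_isSymm h k _) (ih hXY')
      (form_subcritical h k _)
    have := hmono.add (hm.pert_mono (k + 1) X Y hXY)
    rw [form_succ, form_succ, midForm, midForm]
    convert this using 1
    abel

/-- **Lemma 7.5 (iv)**: `A_{k:k+1}^X ⪯ A_{k:k+1}^Y` for `X ⊆ Y`.
[cite: AdamsBuchholzKoteckyMuller2019, Lemma 7.5 (iv)] -/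
theorem midForm_mono {D : ℕ → Matrix Λ Λ ℝ} (h : W.Dominated D) (hm : W.Monotone) (k : ℕ)
    {X Y : Finset Λ} (hXY : X ⊆ Y) : (W.midForm k Y - W.midForm k X).PosSemidef :=
  nextForm_mono (form_isSymm h k _) (form_isSymm h k _) (form_mono h hm k hXY)
    (form_subcritical h k _)

/-- **Theorem 7.1 (w1)**: `w_k^X ≤ w_k^Y` for `X ⊆ Y`.
[cite: AdamsBuchholzKoteckyMuller2019, Theorem 7.1 (w1)] -/
theorem weight_mono {D : ℕ → Matrix Λ Λ ℝ} (h : W.Dominated D) (hm : W.Monotone) (k : ℕ)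
    {X Y : Finset Λ} (hXY : X ⊆ Y) (φ : Λ → ℝ) : W.weight k X φ ≤ W.weight k Y φ :=
  exp_half_quadForm_le_of_posSemidef_sub (form_mono h hm k hXY) φ

/-- **Theorem 7.1 (w1)**: `w_{k:k+1}^X ≤ w_{k:k+1}^Y` for `X ⊆ Y`.
[cite: AdamsBuchholzKoteckyMuller2019, Theorem 7.1 (w1)] -/
theorem midWeight_mono {D : ℕ → Matrix Λ Λ ℝ} (h : W.Dominated D) (hm : W.Monotone) (k : ℕ)
    {X Y : Finset Λ} (hXY : X ⊆ Y) (φ : Λ → ℝ) : W.midWeight k X φ ≤ W.midWeight k Y φ :=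
  exp_half_quadForm_le_of_posSemidef_sub (midForm_mono h hm k hXY) φ

end WeightData

/-! ## Locality (Lemma 7.5 (iii)) -/

/-- **`A` sees only the gradients of the field inside `S`** ([ABKM19] Lemma 7.5 (iii): "the operators
only depend on the values of `φ` in `X^{++}` and they are shift invariant, i.e. measurable with
respect to `∇φ` restricted to `E(X^{++})`"): `Aφ = 0` whenever `φ` is constant on `S` (in particular
`A` kills constants and fields supported off `S`).
[cite: AdamsBuchholzKoteckyMuller2019, Lemma 7.5 (iii)] -/
def IsGradLocal (A : Matrix Λ Λ ℝ) (S : Finset Λ) : Prop :=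
  ∀ φ : Λ → ℝ, (∀ x ∈ S, ∀ y ∈ S, φ x = φ y) → A *ᵥ φ = 0

namespace IsGradLocal

omit [DecidableEq Λ] in
/-- The zero form is local on every set. [cite: AdamsBuchholzKoteckyMuller2019, Lemma 7.5 (iii)] -/
theorem zero (S : Finset Λ) : IsGradLocal (0 : Matrix Λ Λ ℝ) S := fun φ _ => Matrix.zero_mulVec φ

omit [DecidableEq Λ] in
/-- Locality is monotone in the set. [cite: AdamsBuchholzKoteckyMuller2019, Lemma 7.5 (iii)] -/
theorem mono {A : Matrix Λ Λ ℝ} {S S' : Finset Λ} (h : IsGradLocal A S) (hSS' : S ⊆ S') :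
    IsGradLocal A S' :=
  fun φ hφ => h φ fun x hx y hy => hφ x (hSS' hx) y (hSS' hy)

omit [DecidableEq Λ] in
/-- Sums of local forms are local. [cite: AdamsBuchholzKoteckyMuller2019, Lemma 7.5 (iii)] -/
theorem add {A B : Matrix Λ Λ ℝ} {S : Finset Λ} (hA : IsGradLocal A S) (hB : IsGradLocal B S) :
    IsGradLocal (A + B) S :=
  fun φ hφ => by rw [Matrix.add_mulVec, hA φ hφ, hB φ hφ, add_zero]

omit [DecidableEq Λ] in
/-- Scalar multiples of local forms are local. [cite: AdamsBuchholzKoteckyMuller2019, Lemma 7.5 (iii)] -/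
theorem smul {A : Matrix Λ Λ ℝ} {S : Finset Λ} (hA : IsGradLocal A S) (c : ℝ) :
    IsGradLocal (c • A) S :=
  fun φ hφ => by rw [Matrix.smul_mulVec, hA φ hφ, smul_zero]

omit [DecidableEq Λ] in
/-- A right multiple `B A` of a local `A` is local. [cite: AdamsBuchholzKoteckyMuller2019, Lemma 7.5 (iii)] -/
theorem mul_left {A : Matrix Λ Λ ℝ} {S : Finset Λ} (hA : IsGradLocal A S) (B : Matrix Λ Λ ℝ) :
    IsGradLocal (B * A) S :=
  fun φ hφ => by rw [← Matrix.mulVec_mulVec, hA φ hφ, Matrix.mulVec_zero]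

/-- **The Gaussian step preserves locality, for every covariance**:
`nextForm A C = A + (A√C(1−√CA√C)⁻¹√C) A`. [cite: AdamsBuchholzKoteckyMuller2019, Lemma 7.5 (iii)] -/
theorem nextForm {A : Matrix Λ Λ ℝ} {S : Finset Λ} (hA : IsGradLocal A S) (C : Matrix Λ Λ ℝ) :
    IsGradLocal (GradientRG.nextForm A C) S := by
  intro φ hφ
  rw [GradientRG.nextForm, Matrix.add_mulVec, hA φ hφ, zero_add, ← Matrix.mulVec_mulVec, hA φ hφ,
    Matrix.mulVec_zero]

omit [DecidableEq Λ] in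
/-- A local form kills constant fields. [cite: AdamsBuchholzKoteckyMuller2019, Ch. 7.2 (extension by
zero on constants)] -/
theorem mulVec_const {A : Matrix Λ Λ ℝ} {S : Finset Λ} (hA : IsGradLocal A S) (c : ℝ) :
    A *ᵥ (fun _ => c) = 0 :=
  hA _ fun _ _ _ _ => rfl

omit [DecidableEq Λ] in
/-- A local form kills fields vanishing on `S`. [cite: AdamsBuchholzKoteckyMuller2019, Lemma 7.5 (iii)] -/
theorem mulVec_eq_zero_of_forall_mem {A : Matrix Λ Λ ℝ} {S : Finset Λ} (hA : IsGradLocal A S)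
    {φ : Λ → ℝ} (hφ : ∀ x ∈ S, φ x = 0) : A *ᵥ φ = 0 :=
  hA φ fun x hx y hy => by rw [hφ x hx, hφ y hy]

omit [DecidableEq Λ] in
/-- For a SYMMETRIC local form the quadratic form depends only on the field on `S`:
`φ = ψ` on `S` ⇒ `(φ, Aφ) = (ψ, Aψ)`. [cite: AdamsBuchholzKoteckyMuller2019, Lemma 7.5 (iii)] -/
theorem quadForm_eq_of_eqOn {A : Matrix Λ Λ ℝ} {S : Finset Λ} (hA : IsGradLocal A S)
    (hAs : A.IsSymm) {φ ψ : Λ → ℝ} (h : ∀ x ∈ S, φ x = ψ x) :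
    φ ⬝ᵥ A *ᵥ φ = ψ ⬝ᵥ A *ᵥ ψ := by
  have hd : A *ᵥ (φ - ψ) = 0 :=
    hA.mulVec_eq_zero_of_forall_mem fun x hx => by rw [Pi.sub_apply, h x hx, sub_self]
  have hAt : Aᵀ = A := hAs
  have h1 : A *ᵥ φ = A *ᵥ ψ := by
    rw [← sub_eq_zero, ← Matrix.mulVec_sub, hd]
  have h2 : φ ⬝ᵥ A *ᵥ ψ = ψ ⬝ᵥ A *ᵥ ψ := by
    rw [Matrix.dotProduct_mulVec φ A ψ, Matrix.dotProduct_mulVec ψ A ψ, ← Matrix.mulVec_transpose,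
      ← Matrix.mulVec_transpose, hAt, h1]
  rw [h1, h2]

end IsGradLocal

namespace WeightData

variable {W : WeightData Λ}

/-- **Local data**: `nb k X` is the locality set of scale `k` (in [ABKM19] `X^{++}`); the seeds and
the added forms are local, and the enlargement is compatible: `(X*)^{++}_k ⊆ X^{++}_{k+1}`
((7.46)). [cite: AdamsBuchholzKoteckyMuller2019, Lemma 7.5 (iii)] -/
structure Local (nb : ℕ → Finset Λ → Finset Λ) : Prop where
  /-- `A_0^X` is local on `X^{++}` -/
  seed_local : ∀ X, IsGradLocal (W.seed X) (nb 0 X)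
  /-- `M_k^X` is local on `X^{++}` -/
  pert_local : ∀ k X, IsGradLocal (W.pert k X) (nb k X)
  /-- `(X*)^{++}` at scale `k` lies inside `X^{++}` at scale `k+1` -/
  nb_enl : ∀ k X, nb k (W.enl (k + 1) X) ⊆ nb (k + 1) X

/-- **Lemma 7.5 (iii)**: `A_k^X` is local on `X^{++}`.
[cite: AdamsBuchholzKoteckyMuller2019, Lemma 7.5 (iii)] -/
theorem form_isGradLocal {nb : ℕ → Finset Λ → Finset Λ} (h : W.Local nb) :
    ∀ k X, IsGradLocal (W.form k X) (nb k X) := by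
  intro k
  induction k with
  | zero => exact fun X => h.seed_local X
  | succ k ih =>
    intro X
    rw [form_succ, midForm]
    exact (((ih _).nextForm _).mono (h.nb_enl k X)).add (h.pert_local (k + 1) X)

/-- **Lemma 7.5 (iii)**: `A_{k:k+1}^X` is local on `X^{++}`.
[cite: AdamsBuchholzKoteckyMuller2019, Lemma 7.5 (iii)] -/
theorem midForm_isGradLocal {nb : ℕ → Finset Λ → Finset Λ} (h : W.Local nb) (k : ℕ)
    (X : Finset Λ) : IsGradLocal (W.midForm k X) (nb k X) :=
  (form_isGradLocal h k X).nextForm _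

/-- The weights do not see constant shifts of the field: `w_k^X(φ + c) = w_k^X(φ)`
([ABKM19] Ch. 7.2, first paragraph). [cite: AdamsBuchholzKoteckyMuller2019, Ch. 7.2] -/
theorem weight_add_const {nb : ℕ → Finset Λ → Finset Λ} (h : W.Local nb) {D : ℕ → Matrix Λ Λ ℝ}
    (hD : W.Dominated D) (k : ℕ) (X : Finset Λ) (φ : Λ → ℝ) (c : ℝ) :
    W.weight k X (φ + fun _ => c) = W.weight k X φ := by
  have hloc := form_isGradLocal h k X
  have h1 : W.form k X *ᵥ (φ + fun _ => c) = W.form k X *ᵥ φ := by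
    rw [Matrix.mulVec_add, hloc.mulVec_const, add_zero]
  have hAt : (W.form k X)ᵀ = W.form k X := form_isSymm hD k X
  have h2 : (φ + fun _ => c) ⬝ᵥ W.form k X *ᵥ φ = φ ⬝ᵥ W.form k X *ᵥ φ := by
    rw [Matrix.dotProduct_mulVec _ (W.form k X) φ, ← Matrix.mulVec_transpose, hAt, h1,
      Matrix.dotProduct_mulVec φ (W.form k X) φ, ← Matrix.mulVec_transpose, hAt]
  rw [weight, weight, h1, h2]

end WeightData

end Literature.MathematicalPhysics.StatisticalMechanics.GradientRG

end
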